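import Literature.MathematicalPhysics.QuantumFieldTheory.Balaban1983to89.B15Prop1SliceNondegeneracyFromRealCoerciveTower
import HarnessLib

/-!
# BalabanUVNodes ∕ N12 — THE LEVEL-`0` COMPONENTS OF THE SLICE DATUM COORDINATES ARE LINEAR NEAR `0`, SO THE CHART CURVATURE HAS NO `Γ₀` COMPONENT: the letter (R1b) of the
# multiplier row (M) («the curvature data `D²Φ₀(0)[p̂,p̂]` vanish at the level-`0` rows») DISCHARGED — in fact `(D²Φ₀(0)[v,w])_{(0,c)} = 0` for ALL directions
# ([Balaban1988Convergent] (2.2) p. 255, (2.10)–(2.11) p. 256 («M⁰ = id»); [Balaban1985Variational] (81)–(83) p. 290; [Balaban1989LargeFieldII] (1.12) p. 359, (1.19) p. 360)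

Cell `pub-ymgap` (HUMAN RULINGS D-0062 ∕ D-0149), WIDTH SEAT `pub-ymgap-dag-n12-w6` g14 (node N12 = [B15]; key K1⁹ `stmt-QuantumFields-27364`, `--kind proof --supports … --as helper`;
count-neutral; bus 2026-08-29 DAGN12W6-G14 CLAIM-3).  THEOREMS ONLY (0 `def`, 0 `instance`, 0 `sorry`).  CONSUMED BY NAME, nothing modified: dag-n12-w1 ∕ dag-n12-w5's holomorphic chart
`B15SU2ChartHolomorphic` (`expMulC`, `expPointC`, `logCoordC_expPointC`, `decomp_genE`, `genE_trace`), `B15AveragingHolomorphic.iterMh_zero`, `T4AdjointCovarianceUnitary.exp_conj_unitary`, the lane owner's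
`B15Prop1SliceNondegeneracyFromRealCoerciveTower.analyticAt_sliceDatum_of_guardOn` (g24).  dag-n12-w4's `Node00.fderiv_fderiv_msChart_apply_levelZero` is the same fact for NODE 00's REAL chart `msChart`.

WHY.  The (M) producer `…N12SlicePreimageLetterOfClass.multiplierLetter_Bj_of_isMinimizer_class` (this seat, file C) displays (R1b): the curvature data `D²Φ₀(0)[p̂,p̂]` of real kernel
directions vanish at the level-`0` rows `(0, c)`, `c ∈ bondsOf Γ₀`.  At such a row the slice datum coordinate is `logCoordC(U₀(c)⋆·exp(Σ_a X_{c,a}E_a)·U₀(c)) = logCoordC(exp(Ad(U₀(c)⋆)(Σ_a X_{c,a}E_a)))`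
(`M⁰ = id`, `W_0(c) = U₀(c)` on the fibre), i.e. the coordinates of `Ad(U₀(c)⋆)(Σ_a X_{c,a}E_a)` as long as that matrix is `log 2`-small — a continuous LINEAR function of `X` on a neighbourhood of
`0`.  So the derivative of that component is locally constant and its second derivative vanishes, in every pair of directions.

CONTENTS (namespace `Summit.QuantumFields.YangMills.BalabanUVNodes.N12SliceDatumLevelZeroLinear`).
* §1 `fderiv_fderiv_apply_pi'`, `fderiv_fderiv_eq_zero_of_eventuallyEq_clm` (calculus over any `RCLike` field: components of second derivatives; a map agreeing with a continuous linear map near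
  `x₀` has vanishing second derivative there).
* §2 `exists_adCoordsCLM` (`g⋆(Σ_a z_aE_a)g = Σ_a (R z)_aE_a` for a continuous linear `R`, `g ∈ SU(2)`), `sliceDatum_levelZero_eq_near` (the level-`0` component IS `R ∘ eval_c` near `0`).
* §3 ★★★ `fderiv_fderiv_sliceDatum_apply_levelZero` (`(D²Φ₀(0)[v,w])_{(0,c)} = 0` under the per-tower guards and the fibre condition), ★★ `curvatureData_levelZeroFree` (the (R1b) row VERBATIM).

HONEST FRAMING.  Matrix algebra + elementary calculus; nothing of Bałaban's asserted; N12 NOT discharged; K1⁹ NOT closed; counts of record unmoved (typed 28∕28 · discharged 8∕27); one finite 𝕋⁴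
programme at fixed ε — R4 closes the conditional rung `BalabanLadder.UV` only; no summit statement is proved here and NOT the Yang–Mills mass gap (Clay); nothing continuum ∕ ℝ⁴ ∕ OS.
-/

noncomputable section

namespace Summit.QuantumFields.YangMills.BalabanUVNodes.N12SliceDatumLevelZeroLinear

open Set Metric Filter
open scoped Topology BigOperators Matrix.Norms.L2Operator
open Literature.MathematicalPhysics.QuantumFieldTheory.Balaban1983to89
open Literature.MathematicalPhysics.QuantumFieldTheory.Balaban1983to89.Node00 (SU coeField coeField_apply SmallBelow ConstrSet constrCard constrEnum star_coe_mul_coe_SU coe_mul_star_coe_SU coe_inv_SU)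
open T4AdjointCovarianceUnitary (lieSU exp_conj_unitary toUnitary coe_toUnitary)
open B15AveragingHolomorphic (iterMh iterMh_zero)
open B15SU2ChartHolomorphic (genE expMulC expPointC logCoordC logCoordC_expPointC decomp_genE genE_trace)
open B15Prop1SliceNondegeneracyFromRealCoerciveTower (analyticAt_sliceDatum_of_guardOn)
open B15Prop1AnalyticExtClause (cplxVec)
open B15Prop1ChartCalculusSU2 (E3)
open B15Prop1ChartSU2 (su2Chart)
open ExpMeanLog (expMeanLogSU)
open BlockAveraging (blockAvg)
open T4CubeChartGnomonic (SU2)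
open T4Continuum B15DeterminingSets GaugeField

/-! ## §1  Calculus: components of second derivatives; locally linear maps have no second derivative -/

section Calculus

variable {𝕜 : Type*} [RCLike 𝕜] {X V : Type*} [NormedAddCommGroup X] [NormedSpace 𝕜 X] [NormedAddCommGroup V] [NormedSpace 𝕜 V]

/-- Components commute with second derivatives (as dag-n12-w4's `Node00.fderiv_fderiv_apply_pi`, over any `RCLike` field). [folklore] -/
theorem fderiv_fderiv_apply_pi' {ι : Type*} [Fintype ι] {Φ : X → ι → V} {x₀ : X}
    (hd : ∀ᶠ x in 𝓝 x₀, DifferentiableAt 𝕜 Φ x) (hd2 : DifferentiableAt 𝕜 (fderiv 𝕜 Φ) x₀) (i : ι) (w w' : X) :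
    fderiv 𝕜 (fderiv 𝕜 Φ) x₀ w w' i = fderiv 𝕜 (fderiv 𝕜 (fun x => Φ x i)) x₀ w w' := by
  set π : (ι → V) →L[𝕜] V := ContinuousLinearMap.proj i with hπ
  have h1 : (fun x => fderiv 𝕜 (fun x => Φ x i) x) =ᶠ[𝓝 x₀] fun x => (ContinuousLinearMap.compL 𝕜 X (ι → V) V π) (fderiv 𝕜 Φ x) := by
    filter_upwards [hd] with x hx
    exact (π.hasFDerivAt.comp x hx.hasFDerivAt).fderiv
  have h2 : HasFDerivAt (fun x => (ContinuousLinearMap.compL 𝕜 X (ι → V) V π) (fderiv 𝕜 Φ x))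
      ((ContinuousLinearMap.compL 𝕜 X (ι → V) V π).comp (fderiv 𝕜 (fderiv 𝕜 Φ) x₀)) x₀ :=
    (ContinuousLinearMap.compL 𝕜 X (ι → V) V π).hasFDerivAt.comp x₀ hd2.hasFDerivAt
  have h3 : fderiv 𝕜 (fderiv 𝕜 (fun x => Φ x i)) x₀ = (ContinuousLinearMap.compL 𝕜 X (ι → V) V π).comp (fderiv 𝕜 (fderiv 𝕜 Φ) x₀) := by
    rw [show fderiv 𝕜 (fun x => Φ x i) = fun x => fderiv 𝕜 (fun x => Φ x i) x from rfl, h1.fderiv_eq, h2.fderiv]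
  rw [h3]
  rfl

/-- A map that agrees with a continuous linear map on a neighbourhood of `x₀` has vanishing second derivative at `x₀`. [folklore] -/
theorem fderiv_fderiv_eq_zero_of_eventuallyEq_clm {φ : X → V} {L : X →L[𝕜] V} {x₀ : X} (h : φ =ᶠ[𝓝 x₀] fun x => L x) :
    fderiv 𝕜 (fderiv 𝕜 φ) x₀ = 0 := by
  rw [h.fderiv.fderiv_eq]
  have hL : (fderiv 𝕜 fun x => L x) = fun _ => L := by
    funext x
    exact L.hasFDerivAt.fderiv
  rw [hL]
  exact fderiv_const_apply _

end Calculus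

/-! ## §2  The level-`0` component of the slice datum coordinates is linear near `0` -/

section LevelZero

variable {P : Params}

/-- **COORDINATES OF A CONJUGATED `sl₂(ℂ)` ELEMENT**: for `g ∈ SU(2)` there is a continuous ℂ-linear `R : ℂ³ → ℂ³` with `g⋆·(Σ_a z_aE_a)·g = Σ_a (R z)_aE_a` for all `z` (the conjugate is
traceless; `{E_a}` spans the traceless matrices, `decomp_genE`). [cite: Balaban1989LargeFieldII, (1.19) p.360 (bookkeeping); Balaban1985Averaging, (57) p.27] -/
theorem exists_adCoordsCLM (g : SU2) : ∃ R : EuclideanSpace ℂ (Fin 3) →L[ℂ] EuclideanSpace ℂ (Fin 3), ∀ z : EuclideanSpace ℂ (Fin 3),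
    star (g : Matrix (Fin 2) (Fin 2) ℂ) * (∑ a : Fin 3, z a • genE a) * (g : Matrix (Fin 2) (Fin 2) ℂ) = ∑ a : Fin 3, (R z) a • genE a := by
  -- the linear map `z ↦ (−½ tr(E_a · g⋆(Σ z_bE_b)g))_a`
  let M : EuclideanSpace ℂ (Fin 3) →ₗ[ℂ] Matrix (Fin 2) (Fin 2) ℂ :=
    { toFun := fun z => star (g : Matrix (Fin 2) (Fin 2) ℂ) * (∑ a : Fin 3, z a • genE a) * (g : Matrix (Fin 2) (Fin 2) ℂ)
      map_add' := fun z w => by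
        simp only [PiLp.add_apply, add_smul, Finset.sum_add_distrib, Matrix.mul_add, Matrix.add_mul]
      map_smul' := fun c z => by
        simp only [PiLp.smul_apply, smul_eq_mul, RingHom.id_apply, ← smul_smul, ← Finset.smul_sum, Matrix.mul_smul, Matrix.smul_mul] }
  let e : EuclideanSpace ℂ (Fin 3) ≃L[ℂ] (Fin 3 → ℂ) := PiLp.continuousLinearEquiv 2 ℂ (fun _ : Fin 3 => ℂ)
  let Rlin : EuclideanSpace ℂ (Fin 3) →ₗ[ℂ] (Fin 3 → ℂ) := LinearMap.pi fun a =>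
    ((-(1 / 2 : ℂ)) • ((Matrix.traceLinearMap (Fin 2) ℂ ℂ).comp (LinearMap.mulLeft ℂ (genE a)))).comp M
  refine ⟨(e.symm : (Fin 3 → ℂ) →L[ℂ] EuclideanSpace ℂ (Fin 3)).comp (LinearMap.toContinuousLinearMap Rlin), fun z => ?_⟩
  have htr : (star (g : Matrix (Fin 2) (Fin 2) ℂ) * (∑ a : Fin 3, z a • genE a) * (g : Matrix (Fin 2) (Fin 2) ℂ)).trace = 0 := by
    rw [Matrix.trace_mul_cycle, coe_mul_star_coe_SU, one_mul, Matrix.trace_sum]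
    refine Finset.sum_eq_zero fun a _ => ?_
    rw [Matrix.trace_smul, genE_trace, smul_zero]
  have hR : ∀ a, ((e.symm : (Fin 3 → ℂ) →L[ℂ] EuclideanSpace ℂ (Fin 3)).comp (LinearMap.toContinuousLinearMap Rlin)) z a =
      -(1 / 2 : ℂ) * (genE a * (star (g : Matrix (Fin 2) (Fin 2) ℂ) * (∑ b : Fin 3, z b • genE b) * (g : Matrix (Fin 2) (Fin 2) ℂ))).trace := fun a => rfl
  conv_lhs => rw [← decomp_genE (star (g : Matrix (Fin 2) (Fin 2) ℂ) * (∑ a : Fin 3, z a • genE a) * (g : Matrix (Fin 2) (Fin 2) ℂ))]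
  rw [htr, mul_zero, zero_smul, zero_add]
  exact Finset.sum_congr rfl fun a _ => by rw [hR a]

/-- `g⋆·exp(M)·g = exp(g⋆Mg)` for `g ∈ SU(2)` (conjugation by the unitary `g⁻¹`). [cite: Balaban1985Averaging, (57) p.27; Balaban1985BackgroundPropagators, (3.29) p.395] -/
theorem star_mul_exp_mul_eq (g : SU2) (M : Matrix (Fin 2) (Fin 2) ℂ) :
    star (g : Matrix (Fin 2) (Fin 2) ℂ) * NormedSpace.exp M * (g : Matrix (Fin 2) (Fin 2) ℂ)
      = NormedSpace.exp (star (g : Matrix (Fin 2) (Fin 2) ℂ) * M * (g : Matrix (Fin 2) (Fin 2) ℂ)) := by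
  have h := exp_conj_unitary (toUnitary g⁻¹) M
  rw [coe_toUnitary, coe_inv_SU, star_star] at h
  exact h.symm

variable (𝔹 : DetSet P) (k : ℕ) (W : MSField P SU2) {U₀ : GaugeField P 0 SU2}
  (hU₀ : AgreeOn 𝔹 (avgFamily (fun j => blockAvg (P := P) (j := j) expMeanLogSU) U₀) W)
  (S : Submodule ℂ (VecField P 0 (EuclideanSpace ℂ (Fin 3))))
  {Φ₀ : S → Fin (constrCard 𝔹 k) → EuclideanSpace ℂ (Fin 3)}
  (hΦ₀ : ∀ (X : S) i, Φ₀ X i = logCoordC (star ((W ((constrEnum 𝔹 k).symm i).1 ((constrEnum 𝔹 k).symm i).2.1 : SU2) : Matrix (Fin 2) (Fin 2) ℂ) *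
    iterMh ((constrEnum 𝔹 k).symm i).1 (expMulC (X : VecField P 0 (EuclideanSpace ℂ (Fin 3))) (coeField U₀)) ((constrEnum 𝔹 k).symm i).2.1))
include hU₀ hΦ₀

/-- ★ **THE LEVEL-`0` COMPONENT OF THE SLICE DATUM COORDINATES IS LINEAR NEAR `0`**: for `c ∈ bondsOf (𝐁 0)` there is a continuous ℂ-linear `L : S → ℂ³` with `Φ₀ X (0,c) = L X` for all
`X` near `0` — `Φ₀ X (0,c) = logCoordC(U₀(c)⋆·exp(Σ_a X_{c,a}E_a)·U₀(c)) = logCoordC(exp(Σ_a (R X_c)_aE_a)) = R X_c` while `‖Σ_a (R X_c)_aE_a‖ < log 2` (`M⁰ = id`, `W_0(c) = U₀(c)`).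
[cite: Balaban1988Convergent, (2.2) p.255, (2.10)–(2.11) p.256; Balaban1989LargeFieldII, (1.19) p.360; Balaban1985Averaging, (21) p.21] -/
theorem sliceDatum_levelZero_eq_near (c : PBond P 0) (hc : c ∈ bondsOf (𝔹 0)) :
    ∃ L : S →L[ℂ] EuclideanSpace ℂ (Fin 3), ∀ᶠ X in 𝓝 (0 : S), Φ₀ X (constrEnum 𝔹 k ⟨⟨0, Nat.succ_pos k⟩, c, hc⟩) = L X := by
  obtain ⟨R, hR⟩ := exists_adCoordsCLM (U₀ c)
  -- the linear model `X ↦ R (X c)`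
  let ev : S →L[ℂ] EuclideanSpace ℂ (Fin 3) := (ContinuousLinearMap.proj (R := ℂ) c).comp S.subtypeL
  refine ⟨R.comp ev, ?_⟩
  -- the smallness set `‖Σ_a (R (X c))_a E_a‖ < log 2` is a neighbourhood of `0`
  have hcont : Continuous fun X : S => ∑ a : Fin 3, (R (ev X)) a • genE a := by
    refine continuous_finsetSum _ fun a _ => ?_
    exact ((PiLp.continuous_apply 2 (fun _ : Fin 3 => ℂ) a).comp ((R.comp ev).continuous)).smul continuous_const
  have h0 : ‖∑ a : Fin 3, (R (ev (0 : S))) a • genE a‖ < Real.log 2 := by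
    have : ev (0 : S) = 0 := map_zero ev
    rw [this, map_zero]
    simp only [PiLp.zero_apply, zero_smul, Finset.sum_const_zero, norm_zero]
    exact Real.log_pos (by norm_num)
  have hnear : ∀ᶠ X in 𝓝 (0 : S), ‖∑ a : Fin 3, (R (ev X)) a • genE a‖ < Real.log 2 :=
    (hcont.norm.continuousAt (x := (0 : S))).eventually_lt continuousAt_const h0
  filter_upwards [hnear] with X hX
  have hW0 : W 0 c = U₀ c := by
    have h := hU₀ 0 c hc
    exact h.symm
  have hidx : (constrEnum 𝔹 k).symm (constrEnum 𝔹 k ⟨⟨0, Nat.succ_pos k⟩, c, hc⟩) = ⟨⟨0, Nat.succ_pos k⟩, c, hc⟩ := (constrEnum 𝔹 k).symm_apply_apply _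
  rw [hΦ₀, hidx]
  show logCoordC (star ((W 0 c : SU2) : Matrix (Fin 2) (Fin 2) ℂ) * iterMh 0 (expMulC (X : VecField P 0 (EuclideanSpace ℂ (Fin 3))) (coeField U₀)) c) = R (ev X)
  rw [iterMh_zero, hW0]
  show logCoordC (star ((U₀ c : SU2) : Matrix (Fin 2) (Fin 2) ℂ) * (expPointC ((X : VecField P 0 (EuclideanSpace ℂ (Fin 3))) c) * ((U₀ c : SU2) : Matrix (Fin 2) (Fin 2) ℂ))) = R (ev X)
  rw [← mul_assoc, expPointC, star_mul_exp_mul_eq, hR]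
  have hev : (X : VecField P 0 (EuclideanSpace ℂ (Fin 3))) c = ev X := rfl
  rw [hev]
  exact logCoordC_expPointC _ hX

end LevelZero

/-! ## §3  No chart curvature on the `Γ₀` layer; the (R1b) row -/

section Curvature

variable {P : Params}

/-- ★★★ **NO CHART CURVATURE ON THE `Γ₀` LAYER (slice datum coordinates)**: under the per-tower guards of `U₀` on the fibre of `W` (so `Φ₀` is analytic at `0`, the lane owner's
`analyticAt_sliceDatum_of_guardOn`), for every `c ∈ bondsOf (𝐁 0)` and all directions `v w : S`, `(D²Φ₀(0)[v,w])_{(0,c)} = 0` — the component is linear near `0` (§2).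
[cite: Balaban1988Convergent, (2.2) p.255, (2.10)–(2.11) p.256; Balaban1985Variational, (81)–(83) p.290; Balaban1989LargeFieldII, (1.12) p.359] -/
theorem fderiv_fderiv_sliceDatum_apply_levelZero (𝔹 : DetSet P) (k : ℕ) (hk : k ≤ P.m + P.K) (W : MSField P SU2) {U₀ : GaugeField P 0 SU2}
    (hgU : ∀ i : Fin (constrCard 𝔹 k), ∀ j', j' < (((constrEnum 𝔹 k).symm i).1 : ℕ) → ∀ c' : PBond P (j' + 1),
      c' ∈ B10Eq42TorusConstraint.bondsIn (j' + 1) (B14.Eq22Determines.blockIter (((constrEnum 𝔹 k).symm i).1 : ℕ) ⁻¹'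
        ({((constrEnum 𝔹 k).symm i).2.1.src, ((constrEnum 𝔹 k).symm i).2.1.tgt} : Set (Site P ((constrEnum 𝔹 k).symm i).1))) →
        BlockAveraging.Small expMeanLogSU (Averaging.iter (fun j => blockAvg (P := P) (j := j) expMeanLogSU) j' U₀) c')
    (hU₀ : AgreeOn 𝔹 (avgFamily (fun j => blockAvg (P := P) (j := j) expMeanLogSU) U₀) W)
    (S : Submodule ℂ (VecField P 0 (EuclideanSpace ℂ (Fin 3))))
    {Φ₀ : S → Fin (constrCard 𝔹 k) → EuclideanSpace ℂ (Fin 3)}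
    (hΦ₀ : ∀ (X : S) i, Φ₀ X i = logCoordC (star ((W ((constrEnum 𝔹 k).symm i).1 ((constrEnum 𝔹 k).symm i).2.1 : SU2) : Matrix (Fin 2) (Fin 2) ℂ) *
      iterMh ((constrEnum 𝔹 k).symm i).1 (expMulC (X : VecField P 0 (EuclideanSpace ℂ (Fin 3))) (coeField U₀)) ((constrEnum 𝔹 k).symm i).2.1))
    (c : PBond P 0) (hc : c ∈ bondsOf (𝔹 0)) (v w : S) :
    fderiv ℂ (fderiv ℂ Φ₀) 0 v w (constrEnum 𝔹 k ⟨⟨0, Nat.succ_pos k⟩, c, hc⟩) = 0 := by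
  have han : AnalyticAt ℂ Φ₀ 0 := analyticAt_sliceDatum_of_guardOn S 𝔹 k hk W hgU hU₀ hΦ₀
  have hcd : ContDiffAt ℂ 2 Φ₀ 0 := han.contDiffAt
  have hd : ∀ᶠ X in 𝓝 (0 : S), DifferentiableAt ℂ Φ₀ X := by
    have h := hcd.eventually (by simp)
    filter_upwards [h] with X hX
    exact hX.differentiableAt (by simp)
  have hd2 : DifferentiableAt ℂ (fderiv ℂ Φ₀) 0 := by
    have h := hcd.fderiv_right (m := 1) (by norm_num)
    exact h.differentiableAt (by simp)
  obtain ⟨L, hL⟩ := sliceDatum_levelZero_eq_near 𝔹 k W hU₀ S hΦ₀ c hc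
  rw [fderiv_fderiv_apply_pi' hd hd2, fderiv_fderiv_eq_zero_of_eventuallyEq_clm hL]
  rfl

/-- ★★ **THE (R1b) ROW DISCHARGED**: the curvature data of real kernel directions vanish at the level-`0` rows — the hypothesis `hAdm` of this seat's
`…N12SlicePreimageLetterOfClass.multiplierLetter_Bj_of_isMinimizer_class` VERBATIM (indeed for every real slice direction, kernel or not).
[cite: Balaban1988Convergent, (2.2) p.255, (2.10)–(2.11) p.256; Balaban1985Variational, (81)–(83) p.290; Balaban1989LargeFieldII, (1.12) p.359] -/
theorem curvatureData_levelZeroFree (𝔹 : DetSet P) (k : ℕ) (hk : k ≤ P.m + P.K) (W : MSField P SU2) {U₀ : GaugeField P 0 SU2}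
    (hgU : ∀ i : Fin (constrCard 𝔹 k), ∀ j', j' < (((constrEnum 𝔹 k).symm i).1 : ℕ) → ∀ c' : PBond P (j' + 1),
      c' ∈ B10Eq42TorusConstraint.bondsIn (j' + 1) (B14.Eq22Determines.blockIter (((constrEnum 𝔹 k).symm i).1 : ℕ) ⁻¹'
        ({((constrEnum 𝔹 k).symm i).2.1.src, ((constrEnum 𝔹 k).symm i).2.1.tgt} : Set (Site P ((constrEnum 𝔹 k).symm i).1))) →
        BlockAveraging.Small expMeanLogSU (Averaging.iter (fun j => blockAvg (P := P) (j := j) expMeanLogSU) j' U₀) c')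
    (hU₀ : AgreeOn 𝔹 (avgFamily (fun j => blockAvg (P := P) (j := j) expMeanLogSU) U₀) W)
    (S : Submodule ℂ (VecField P 0 (EuclideanSpace ℂ (Fin 3))))
    {Φ₀ : S → Fin (constrCard 𝔹 k) → EuclideanSpace ℂ (Fin 3)}
    (hΦ₀ : ∀ (X : S) i, Φ₀ X i = logCoordC (star ((W ((constrEnum 𝔹 k).symm i).1 ((constrEnum 𝔹 k).symm i).2.1 : SU2) : Matrix (Fin 2) (Fin 2) ℂ) *
      iterMh ((constrEnum 𝔹 k).symm i).1 (expMulC (X : VecField P 0 (EuclideanSpace ℂ (Fin 3))) (coeField U₀)) ((constrEnum 𝔹 k).symm i).2.1)) :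
    ∀ (p : VecField P 0 E3) (hp : cplxVec p ∈ S), fderiv ℂ Φ₀ 0 ⟨cplxVec p, hp⟩ = 0 →
      ∀ (b : PBond P 0) (hb : b ∈ bondsOf (𝔹 0)),
        fderiv ℂ (fderiv ℂ Φ₀) 0 ⟨cplxVec p, hp⟩ ⟨cplxVec p, hp⟩ (constrEnum 𝔹 k ⟨⟨0, Nat.succ_pos k⟩, b, hb⟩) = 0 :=
  fun _ _ _ b hb => fderiv_fderiv_sliceDatum_apply_levelZero 𝔹 k hk W hgU hU₀ S hΦ₀ b hb _ _

end Curvature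

end Summit.QuantumFields.YangMills.BalabanUVNodes.N12SliceDatumLevelZeroLinear

end
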